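import Summits.AtomisticToContinuum.HydrodynamicLimit.Theorems.InformationPercolationEngineChaosClosesEulerReductionFrameD
import Summits.AtomisticToContinuum.HydrodynamicLimit.Theorems.InformationPercolationEngineChaosClosesEulerReductionFrameB
import Literature.MathematicalPhysics.KineticTheory.HardSphereTwoTimePressure
import HarnessLib

/-!
# Kinetic reduction (crux `ChaosClosesEuler`, stmt-AtomisticToContinuum-15141, line `Sketch`,
# stub `stub_kineticReduction`) — helper: the thresholds `r₀`, `N₀`, cold-clamped shell with `C¹` tests (v8)

WHAT. `reduction_thresholds_cold`: the analogue of `reduction_thresholds` (helper `ReductionFrameB`) for the corrected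
shell (skeleton v8: `E ≥ 0` hypothesised, the entropy weight of EXACTLY COLD cone states is the lower cut-off `a₁`,
(H1) over `C¹` space–time tests). With every deterministic tolerance fixed — among them the thinness level `lam` of
cold cones, `0 < lam ≤ 1` — the in-probability inputs, read at the grid times with the fixed bumps, cut-off and entropy
tests, have finitely many thresholds; below the common `r₀` and beyond the common `N₀` (also large enough for the
particle diameter, and — NEW — for the single-particle cones to be `lam²`-thin, `(N+1)⁻¹ · 3/(π r³) ≤ lam²`, by
Archimedes: `stub_reductionFrameE`, the threshold depending on the already fixed `r`) the eleven bad events are small,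
the local Gibbs law is absolutely continuous with respect to the Liouville measure (`localGibbsLaw_absolutelyContinuous`),
and the union bound `reduction_events_cold` (helper `ReductionFrameD`) gives the deviation bound of the time-averaged
`L¹` distance.

WHY (for the final tolerance choice). Compared with `reduction_thresholds` of `ReductionFrameB` the statement of
`reduction_thresholds_cold` differs EXACTLY as follows, everything else (hypotheses, their order, the in-probability
inputs `HKE HU HC HW HP HL HD HI`, the conclusion) being verbatim:
* `hf : ContinuousOn f (Ioi 0)` is inserted right after `hχ`;
* the shell hypothesis `hSH` is in its v8 text: the extra premise `(∀ s x, 0 ≤ (V s x).2.2)` after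
  `(∀ s x, 0 ≤ (V s x).1)`, the cold entropy weight
  `Zs U := if 0 < θo U then max a₁ (min (3/2 log (θo U) - log U.1 - f U.1) b₁) else a₁`, and (H1) quantified over
  `ContDiff ℝ 1 (Torus.stLift φ)` instead of `Torus.IsSmoothSpaceTimeOn Set.univ φ`;
* the block `{lam : ℝ} (hlam : 0 < lam) (hlam1 : lam ≤ 1)` is inserted right before the budget block (before `hδpos`);
* the entropy smallness condition `hS3` carries the extra (cold) summand
  `(t + (m+1)Δ - 0) * (2 * max |a₁| |b₁| * lam * ((Cθ * 1 + Cθ * (C/Δ)) + Cθ/2) + 2 * max |a₁| |b₁| * lam * Cθ * KE + 0)`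
  on its left-hand side.

No named fact is invoked.
-/

noncomputable section

namespace Summit.AtomisticToContinuum.HydrodynamicLimit.Theorems.ChaosClosesEulerReduction

open scoped BigOperators Topology Classical MeasureTheory InnerProductSpace ENNReal
open Filter Set MeasureTheory Function
open Literature.MathematicalPhysics.KineticTheory
open Literature.Analysis.FluidPDE
open Literature.Analysis.FunctionSpaces
open Summit.AtomisticToContinuum.HydrodynamicLimit.Theorems.LocalSecondLawNegative
open Summit.AtomisticToContinuum.HydrodynamicLimit.Theorems.LocalSecondLawLedger
open Summit.AtomisticToContinuum.HydrodynamicLimit.Theorems.LocalSecondLawLedger.L (Mmom)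

/-! ## §1 The registered sub-goal: the thinness threshold -/

/-- **Registered sub-goal `stub_reductionFrameE` (helper of `stub_kineticReduction`): Archimedes** — beyond a
threshold `(N+1)⁻¹ c ≤ l`; with `c := 3/(π r³)`, `l := lam²` it makes the single-particle cones `lam²`-thin.
[folklore] -/
theorem stub_reductionFrameE : ∀ (c : ℝ) {l : ℝ}, 0 < l → ∃ N₀ : ℕ, ∀ N : ℕ, N₀ ≤ N → ((N + 1 : ℕ) : ℝ)⁻¹ * c ≤ l := by
  intro c l hl
  obtain ⟨N₀, hN₀⟩ := exists_nat_gt (c / l)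
  refine ⟨N₀, fun N hN => ?_⟩
  rw [inv_mul_le_iff₀ (by positivity)]
  have h1 : c < (N₀ : ℝ) * l := (div_lt_iff₀ hl).1 hN₀
  have h2 : (N₀ : ℝ) ≤ ((N + 1 : ℕ) : ℝ) := by exact_mod_cast hN.trans (Nat.le_succ N)
  nlinarith

/-! ## §2 The thresholds -/

set_option maxHeartbeats 3200000 in
/-- **THE THRESHOLDS, COLD-CLAMPED SHELL WITH `C¹` TESTS (v8).** See the module docstring. [folklore] -/
theorem reduction_thresholds_cold {a₀ θ₀ : T3 → ℝ} {u₀ : T3 → V3} {σ : ℝ} (hσ : 0 < σ) (hσ2 : σ < 2⁻¹)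
    (Φ : (N : ℕ) → HardSphereFlow (Torus.geometry (Fin 3)) (hsDiameter σ N) (N + 1))
    {T : ℝ} {ρ θ : ℝ → T3 → ℝ} {u : ℝ → T3 → V3} (hE : IsHardSphereEulerSolution σ T ρ u θ)
    {t Δ e : ℝ} {m : ℕ} (ht0 : 0 ≤ t) (hΔ : 0 < Δ) (he : 0 < e) (hT : t + (m + 1 : ℕ) * Δ + e < T)
    -- the shell at this `σ`, horizon `t + (m+1)Δ`, window `Δ`, defect `δ` (v8 text; NEW: `hf`)
    {η₁ a₁ b₁ ε' δ : ℝ} {χe f : ℝ → ℝ} (hχ : ContinuousOn χe (Ioi 0)) (hf : ContinuousOn f (Ioi 0))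
    {B : ℝ} (hB0 : 0 ≤ B) (hB : ∀ a, 0 < a → |χe a| ≤ B)
    (hband : ∀ a, 0 < a → a * σ ^ 3 ≤ η₁ → χe a = hsCompressibility (a * σ ^ 3))
    (hfband : ∀ a, 0 < a → a * σ ^ 3 ≤ η₁ → f a = hsExcessFreeEnergy (a * σ ^ 3))
    (hFc : ContinuousOn (fun c => hsExcessFreeEnergy (min c η₁) + deriv hsExcessFreeEnergy η₁ * max (c - η₁) 0) (Ici 0))
    (hSH : ∀ V : ℝ → T3 → ℝ × V3 × ℝ, Measurable (Function.uncurry V) →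
      (∃ C : ℝ, ∀ s x, |(V s x).1| ≤ C ∧ ‖(V s x).2.1‖ ≤ C ∧ |(V s x).2.2| ≤ C) →
      (∀ s x, 0 ≤ (V s x).1) → (∀ s x, 0 ≤ (V s x).2.2) →
      (∀ s x, ‖(V s x).2.1‖ ^ 2 ≤ 2 * (V s x).1 * (V s x).2.2) →
      let θo : ℝ × V3 × ℝ → ℝ := fun U => 2 / 3 * (U.2.2 / U.1 - ‖U.2.1‖ ^ 2 / (2 * U.1 ^ 2))
      let pV : ℝ × V3 × ℝ → ℝ := fun U => U.1 * θo U * χe U.1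
      let Zs : ℝ × V3 × ℝ → ℝ := fun U => if 0 < θo U then max a₁ (min (3 / 2 * Real.log (θo U) - Real.log U.1 - f U.1) b₁) else a₁
      let Etot : ℝ → T3 → ℝ := fun s x => totalEnergyDensity (ρ s x) (u s x) (θ s x)
      let cut : ℝ → ℝ → ℝ := fun τ₀ s => Real.smoothTransition ((τ₀ + Δ - s) / Δ)
      (∀ φ : ℝ → T3 → ℝ, ContDiff ℝ 1 (Torus.stLift φ) → ∀ τ ∈ Set.Icc 0 (t + (m + 1 : ℕ) * Δ), (∫ x, φ τ x * (V τ x).1) - ∫ x, φ 0 x * (V 0 x).1 = ∫ s in Set.Icc 0 τ, ∫ x, (deriv (fun s' => φ s' x) s * (V s x).1 + ∑ k : Fin 3, (V s x).2.1 k * Torus.partialDeriv k (φ s) x)) →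
      (∀ τ ∈ Set.Icc 0 (t + (m + 1 : ℕ) * Δ), |(∫ x, ⟪u τ x, (V τ x).2.1⟫_ℝ) - (∫ x, ⟪u 0 x, (V 0 x).2.1⟫_ℝ) - ∫ s in Set.Icc 0 τ, ∫ x, (⟪Torus.timeDerivWithin (Set.Ico 0 T) u s x, (V s x).2.1⟫_ℝ + ∑ i : Fin 3, ∑ j : Fin 3, Torus.partialDeriv j (fun y => u s y i) x * ((V s x).2.1 i * (V s x).2.1 j / (V s x).1 + if i = j then pV (V s x) else 0))| ≤ δ) →
      (∀ τ₀ ∈ Set.Icc 0 (t + (m + 1 : ℕ) * Δ - Δ), (∫ s in Set.Icc 0 (t + (m + 1 : ℕ) * Δ), ∫ x, ((V s x).1 * Zs (V s x) * Torus.timeDerivWithin (Set.Ico 0 T) (fun s' y => θ s' y * cut τ₀ s') s x + Zs (V s x) * ⟪(V s x).2.1, Torus.gradient (fun y => θ s y * cut τ₀ s) x⟫_ℝ)) + ∫ x, (V 0 x).1 * Zs (V 0 x) * (θ 0 x * cut τ₀ 0) ≤ δ) →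
      (∀ τ ∈ Set.Icc 0 (t + (m + 1 : ℕ) * Δ), ∫ x, (V τ x).2.2 ≤ (∫ x, (V 0 x).2.2) + δ) →
      (∀ x, |(V 0 x).1 - ρ 0 x| ≤ δ ∧ ‖(V 0 x).2.1 - ρ 0 x • u 0 x‖ ≤ δ ∧ |(V 0 x).2.2 - Etot 0 x| ≤ δ) →
      ∀ τ₀ ∈ Set.Icc 0 (t + (m + 1 : ℕ) * Δ - Δ), ∫ s in Set.Icc τ₀ (τ₀ + Δ), ∫ x, (|(V s x).1 - ρ s x| + ‖(V s x).2.1 - ρ s x • u s x‖ + |(V s x).2.2 - Etot s x|) ≤ ε' * Δ)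
    -- guard, cap, cut-off levels
    {η₀g ηcap ηg ηg2 : ℝ} (hη₀g0 : 0 ≤ η₀g) (hguard : ∀ s ∈ Ico 0 T, ∀ x, ρ s x * σ ^ 3 < η₀g) (hcap0 : 0 ≤ ηcap)
    (hη₁cap : η₀g + ηcap ≤ η₁) (hg12 : ηg < ηg2) (hη₀gg : η₀g ≤ ηg / 2) (hcapg : ηcap ≤ ηg / 2)
    -- energy level, collision tail, equation of state, grids
    {KE : ℝ} (hKE0 : 0 ≤ KE) {δ₁ : ℝ} (hδ₁ : 0 < δ₁)
    (HKE : ∀ N : ℕ, localGibbsLaw σ a₀ u₀ θ₀ N (Φ N) {z | KE < ((N : ℝ) + 1)⁻¹ * configEnergy ((Φ N).flow 0 z)} ≤ ENNReal.ofReal δ₁)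
    {Lv η₂ : ℝ} {N₀U : ℕ} (HU : ∀ N : ℕ, N₀U ≤ N → localGibbsLaw σ a₀ u₀ θ₀ N (Φ N) {z | η₂ < hsDiameter σ N / ((N : ℝ) + 1) *
      (∑ᶠ (s : ℝ) (_ : s ∈ collisionTimes (Torus.geometry (Fin 3)) (hsDiameter σ N) (fun s => (Φ N).flow s z) ∩
        Set.Icc 0 (t + (m + 1 : ℕ) * Δ + e)), ∑ i : Fin (N + 1), ∑ j : Fin (N + 1),
        (if i ≠ j ∧ ‖(Torus.geometry (Fin 3)).sepVec ((Φ N).flow s z i).1 ((Φ N).flow s z j).1‖ = hsDiameter σ N then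
          (if Lv < ‖((Φ N).flow s z i).2‖ ^ 2 + ‖((Φ N).flow s z j).2‖ ^ 2 then
            1 + ‖((Φ N).flow s z i).2‖ ^ 2 + ‖((Φ N).flow s z j).2‖ ^ 2 else 0) else 0))} ≤ ENNReal.ofReal δ₁)
    {CY : ℝ} (hCY0 : 0 ≤ CY) (hCY : ∀ a ∈ Set.Icc 0 ηg2, |deriv hsExcessFreeEnergy a| ≤ CY)
    {n : ℕ} (hn : 1 ≤ n) (hne : ((t + (m + 1 : ℕ) * Δ) / n) ≤ e) {η₃ : ℝ} (hη₃ : 0 < η₃)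
    (HC : ∀ χ : ℝ × T3 → ℝ, Continuous χ → ∀ η' δ' : ℝ, 0 < η' → 0 < δ' → ∃ r₀ : ℝ, 0 < r₀ ∧ ∀ r : ℝ, 0 < r → r < r₀ → ∃ N₀ : ℕ, ∀ N : ℕ, N₀ ≤ N →
      localGibbsLaw σ a₀ u₀ θ₀ N (Φ N) {z | η' < |hsDiameter σ N / ((N : ℝ) + 1) *
      (∑ᶠ (s : ℝ) (_ : s ∈ collisionTimes (Torus.geometry (Fin 3)) (hsDiameter σ N) (fun s => (Φ N).flow s z) ∩
        Set.Icc 0 (t + (m + 1 : ℕ) * Δ + e)), ∑ i : Fin (N + 1), ∑ j : Fin (N + 1),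
        (if i ≠ j ∧ ‖(Torus.geometry (Fin 3)).sepVec ((Φ N).flow s z i).1 ((Φ N).flow s z j).1‖ = hsDiameter σ N then
          χ (s, ((Φ N).flow s z i).1) *
            max 0 (min 1 ((ηg2 - σ ^ 3 * DensityCapNegative.mollDensity r ((Φ N).flow s z) ((Φ N).flow s z i).1) / (ηg2 - ηg)))
          else 0)) -
      σ ^ 3 * ∫ s in Set.Icc (0 : ℝ) (t + (m + 1 : ℕ) * Δ + e), ∫ x : T3,
        χ (s, x) *
          max 0 (min 1 ((ηg2 - σ ^ 3 * DensityCapNegative.mollDensity r ((Φ N).flow s z) x) / (ηg2 - ηg))) *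
          (3 / (2 * Real.pi) * deriv hsExcessFreeEnergy (σ ^ 3 * DensityCapNegative.mollDensity r ((Φ N).flow s z) x)) *
          ∫ p, cone r p.1.1 x * cone r p.2.1 x * (Real.pi * ‖p.1.2 - p.2.2‖)
            ∂((empiricalMeasure ((Φ N).flow s z)).prod (empiricalMeasure ((Φ N).flow s z)))|} ≤ ENNReal.ofReal δ')
    -- the classical velocity: bounds, shift moduli, space modulus of the gradient
    {Cu : ℝ} (hCu : 0 ≤ Cu) (hut : ∀ s ∈ Icc 0 (t + (m + 1 : ℕ) * Δ + e), ∀ x, ‖Torus.timeDerivWithin (Ico 0 T) u s x‖ ≤ Cu)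
    (hD : ∀ s ∈ Icc 0 (t + (m + 1 : ℕ) * Δ + e), ∀ x, ∀ i j : Fin 3, |Torus.partialDeriv j (fun y => u s y i) x| ≤ Cu)
    {ω : ℝ} (hω : 0 ≤ ω) (hωu : ∀ s ∈ Icc 0 (t + (m + 1 : ℕ) * Δ), ∀ x, ‖u (s + e) x - u s x‖ ≤ ω)
    (hωt : ∀ s ∈ Icc 0 (t + (m + 1 : ℕ) * Δ), ∀ x,
      ‖Torus.timeDerivWithin (Ico 0 T) u (s + e) x - Torus.timeDerivWithin (Ico 0 T) u s x‖ ≤ ω)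
    (hωD : ∀ s ∈ Icc 0 (t + (m + 1 : ℕ) * Δ), ∀ x, ∀ i j : Fin 3,
      |Torus.partialDeriv j (fun y => u (s + e) y i) x - Torus.partialDeriv j (fun y => u s y i) x| ≤ ω)
    {ωx dX : ℝ} (hωx0 : 0 ≤ ωx) (hdX : 0 < dX) (hωx : ∀ s ∈ Icc 0 (t + (m + 1 : ℕ) * Δ), ∀ x y : T3, Torus.euclidDist x y < dX →
      ∀ i j : Fin 3, |Torus.partialDeriv j (fun y => u (s + e) y i) x - Torus.partialDeriv j (fun y' => u (s + e) y' i) y| ≤ ωx)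
    {ηW ηP : ℝ} (hηW : 0 < ηW) (hηP : 0 < ηP)
    (HW : ∀ t' ∈ Ico 0 T, ∀ a : Fin 3 → Fin 3 → ℝ × T3 → ℝ, (∀ j k, Continuous (a j k)) → (∀ p, ∑ j : Fin 3, a j j p = 0) →
      ∀ η' δ' : ℝ, 0 < η' → 0 < δ' → ∃ r₀ : ℝ, 0 < r₀ ∧ ∀ r : ℝ, 0 < r → r < r₀ → ∃ N₀ : ℕ, ∀ N : ℕ, N₀ ≤ N →
      localGibbsLaw σ a₀ u₀ θ₀ N (Φ N) {z | η' < |∫ s in Icc 0 t', ∫ x,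
        max 0 (min 1 ((ηg2 - σ ^ 3 * rhoC r ((Φ N).flow s z) x) / (ηg2 - ηg))) *
        ∑ j : Fin 3, ∑ k : Fin 3, a j k (s, x) *
          (Mmom r ((Φ N).flow s z) x j k - momC r ((Φ N).flow s z) x j * momC r ((Φ N).flow s z) x k / rhoC r ((Φ N).flow s z) x)|} ≤
        ENNReal.ofReal δ')
    (HP : ∀ t' ∈ Ico 0 T, ∀ a : Fin 3 → Fin 3 → ℝ × T3 → ℝ, (∀ j k, Continuous (a j k)) → (∀ j k p, a j k p = a k j p) →
      ∀ η' δ' : ℝ, 0 < η' → 0 < δ' → ∃ r₀ : ℝ, 0 < r₀ ∧ ∀ r : ℝ, 0 < r → r < r₀ → ∃ N₀ : ℕ, ∀ N : ℕ, N₀ ≤ N →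
      localGibbsLaw σ a₀ u₀ θ₀ N (Φ N) {z | η' < |hsDiameter σ N / (N + 1 : ℝ) *
        (∑ᶠ (s : ℝ) (_ : s ∈ collisionTimes (Torus.geometry (Fin 3)) (hsDiameter σ N) (fun s => (Φ N).flow s z) ∩
          Set.Icc 0 t'), ∑ i : Fin (N + 1), ∑ j : Fin (N + 1),
          (if i ≠ j ∧ ‖(Torus.geometry (Fin 3)).sepVec ((Φ N).flow s z i).1 ((Φ N).flow s z j).1‖ = hsDiameter σ N then
            max 0 (min 1 ((ηg2 - σ ^ 3 * rhoC r ((Φ N).flow s z) ((Φ N).flow s z i).1) / (ηg2 - ηg))) *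
            |⟪(vin ((Φ N).flow s z) i j).1 - (vin ((Φ N).flow s z) i j).2, nrm (hsDiameter σ N) ((Φ N).flow s z) i j⟫_ℝ| *
            ∑ k : Fin 3, ∑ l : Fin 3, a k l (s, ((Φ N).flow s z i).1) *
              (nrm (hsDiameter σ N) ((Φ N).flow s z) i j k * nrm (hsDiameter σ N) ((Φ N).flow s z) i j l) else 0)) -
        2 * ∫ s in Icc 0 t', ∫ x,
          max 0 (min 1 ((ηg2 - σ ^ 3 * rhoC r ((Φ N).flow s z) x) / (ηg2 - ηg))) *
          (hsPressure σ (rhoC r ((Φ N).flow s z) x) (thetaC r ((Φ N).flow s z) x) - rhoC r ((Φ N).flow s z) x * thetaC r ((Φ N).flow s z) x) *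
          ∑ k : Fin 3, a k k (s, x)|} ≤ ENNReal.ofReal δ')
    (hθ : Torus.IsSmoothSpaceTimeOn (Ico 0 T) θ)
    {Cθ : ℝ} (hCθ : 0 ≤ Cθ) (hθb : ∀ s ∈ Icc 0 (t + (m + 1 : ℕ) * Δ + e), ∀ x, |θ s x| ≤ Cθ)
    (hθt : ∀ s ∈ Icc 0 (t + (m + 1 : ℕ) * Δ + e), ∀ x, |Torus.timeDerivWithin (Ico 0 T) θ s x| ≤ Cθ)
    (hθx : ∀ s ∈ Icc 0 (t + (m + 1 : ℕ) * Δ + e), ∀ x, ‖Torus.gradient (θ s) x‖ ≤ Cθ)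
    (hωθ : ∀ s ∈ Icc 0 (t + (m + 1 : ℕ) * Δ), ∀ x, |θ (s + e) x - θ s x| ≤ ω)
    (hωθt : ∀ s ∈ Icc 0 (t + (m + 1 : ℕ) * Δ), ∀ x,
      |Torus.timeDerivWithin (Ico 0 T) θ (s + e) x - Torus.timeDerivWithin (Ico 0 T) θ s x| ≤ ω)
    (hωθx : ∀ s ∈ Icc 0 (t + (m + 1 : ℕ) * Δ), ∀ x, ‖Torus.gradient (θ (s + e)) x - Torus.gradient (θ s) x‖ ≤ ω)
    {C : ℝ} (hC1 : ∀ x, |deriv Real.smoothTransition x| ≤ C) (hC2 : ∀ x, |deriv (deriv Real.smoothTransition) x| ≤ C)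
    {n' : ℕ} (hn' : 1 ≤ n') {ηL : ℝ} (hηL : 0 < ηL)
    (HL : ∀ φ : ℝ → T3 → ℝ, Torus.IsSmoothSpaceTimeOn Set.univ φ → (∀ s x, 0 ≤ φ s x) →
      (∃ τ' : ℝ, τ' < (t + (m + 1 : ℕ) * Δ + e) ∧ ∀ s, τ' ≤ s → ∀ x, φ s x = 0) → ∀ η' δ' : ℝ, 0 < η' → 0 < δ' → ∃ r₀ : ℝ, 0 < r₀ ∧ ∀ r : ℝ, 0 < r → r < r₀ → ∃ N₀ : ℕ, ∀ N : ℕ, N₀ ≤ N →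
      localGibbsLaw σ a₀ u₀ θ₀ N (Φ N) {z | η' < (∫ s in Icc 0 (t + (m + 1 : ℕ) * Δ + e), ∫ x,
        (rhoC r ((Φ N).flow s z) x * max a₁ (min (3 / 2 * Real.log (thetaC r ((Φ N).flow s z) x) - Real.log (rhoC r ((Φ N).flow s z) x) -
          (hsExcessFreeEnergy (min (rhoC r ((Φ N).flow s z) x * σ ^ 3) η₁) +
            deriv hsExcessFreeEnergy η₁ * max (rhoC r ((Φ N).flow s z) x * σ ^ 3 - η₁) 0)) b₁) * Torus.timeDeriv φ s x +
        max a₁ (min (3 / 2 * Real.log (thetaC r ((Φ N).flow s z) x) - Real.log (rhoC r ((Φ N).flow s z) x) -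
          (hsExcessFreeEnergy (min (rhoC r ((Φ N).flow s z) x * σ ^ 3) η₁) +
            deriv hsExcessFreeEnergy η₁ * max (rhoC r ((Φ N).flow s z) x * σ ^ 3 - η₁) 0)) b₁) *
          ⟪momC r ((Φ N).flow s z) x, Torus.gradient (φ s) x⟫_ℝ)) +
        ∫ x, rhoC r ((Φ N).flow 0 z) x * max a₁ (min (3 / 2 * Real.log (thetaC r ((Φ N).flow 0 z) x) - Real.log (rhoC r ((Φ N).flow 0 z) x) -
          (hsExcessFreeEnergy (min (rhoC r ((Φ N).flow 0 z) x * σ ^ 3) η₁) +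
            deriv hsExcessFreeEnergy η₁ * max (rhoC r ((Φ N).flow 0 z) x * σ ^ 3 - η₁) 0)) b₁) * φ 0 x} ≤ ENNReal.ofReal δ')
    (HD : ∀ η' δ' : ℝ, 0 < η' → 0 < δ' → ∃ r₀ : ℝ, 0 < r₀ ∧ ∀ r : ℝ, 0 < r → r < r₀ → ∃ N₀ : ℕ, ∀ N : ℕ, N₀ ≤ N →
      localGibbsLaw σ a₀ u₀ θ₀ N (Φ N) {z | ∃ s ∈ Set.Icc 0 (t + (m + 1 : ℕ) * Δ + e), ∃ x : T3, ρ s x + η' < rhoC r ((Φ N).flow s z) x} ≤ ENNReal.ofReal δ')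
    (HI : ∀ η' δ' : ℝ, 0 < η' → 0 < δ' → ∃ r₀ : ℝ, 0 < r₀ ∧ ∀ r : ℝ, 0 < r → r < r₀ → ∃ N₀ : ℕ, ∀ N : ℕ, N₀ ≤ N →
      localGibbsLaw σ a₀ u₀ θ₀ N (Φ N) {z | ∃ x, η' < |rhoC r ((Φ N).flow 0 z) x - ρ 0 x|} ≤ ENNReal.ofReal δ' ∧
      localGibbsLaw σ a₀ u₀ θ₀ N (Φ N) {z | ∃ x, η' < ‖momC r ((Φ N).flow 0 z) x - ρ 0 x • u 0 x‖} ≤ ENNReal.ofReal δ' ∧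
      localGibbsLaw σ a₀ u₀ θ₀ N (Φ N) {z | ∃ x, η' < |kinC r ((Φ N).flow 0 z) x - totalEnergyDensity (ρ 0 x) (u 0 x) (θ 0 x)|} ≤ ENNReal.ofReal δ')
    -- NEW (v8): the thinness level of cold cones, a deterministic tolerance
    {lam : ℝ} (hlam : 0 < lam) (hlam1 : lam ≤ 1)
    -- the budget (NEW (v8): the cold summand of the entropy condition `hS3`)
    (hδpos : 0 < δ) (hcappos : 0 < ηcap) {B3 ε₁ : ℝ} (hε₁ : 0 < ε₁) (hB3 : 3 / 2 * Cu * ε₁ * (2 + 8 * KE) ≤ B3)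
    (hS2 : ηW + ηP / 2 + B3 +
        3 / 2 * ωx * ((1 + max Lv 0) * (η₃ + σ ^ 3 * (3 * (t + (m + 1 : ℕ) * Δ) * (3 / (2 * Real.pi) * CY) *
          (2 * Real.pi * (η₀g / σ ^ 3 + ηcap) * (1 / 2 + KE)))) + η₂) +
        (t + (m + 1 : ℕ) * Δ) / n * ((60 * Cu + 2 * Cu * (1 + B)) * KE) +
        3 / 2 * Cu * ((1 + max Lv 0) * (η₃ + σ ^ 3 * (3 * ((t + (m + 1 : ℕ) * Δ) / n) * (3 / (2 * Real.pi) * CY) *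
          (2 * Real.pi * (η₀g / σ ^ 3 + ηcap) * (1 / 2 + KE)))) + η₂) +
        ω * ((1 + 2 * KE) + (t + (m + 1 : ℕ) * Δ) * ((7 + 2 * B) * KE + 1 / 2)) ≤ δ)
    (hS3 : ηL + ((t + (m + 1 : ℕ) * Δ) * (max |a₁| |b₁| * (Cθ * (C / Δ * (((t + (m + 1 : ℕ) * Δ) - Δ) / n'))) * KE +
          (max |a₁| |b₁| * (Cθ * (C / Δ * (((t + (m + 1 : ℕ) * Δ) - Δ) / n')) + Cθ * (C / Δ ^ 2 * (((t + (m + 1 : ℕ) * Δ) - Δ) / n'))) +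
            max |a₁| |b₁| * (Cθ * (C / Δ * (((t + (m + 1 : ℕ) * Δ) - Δ) / n'))) / 2)) +
        max |a₁| |b₁| * Cθ * (C / Δ * (((t + (m + 1 : ℕ) * Δ) - Δ) / n'))) +
      ((t + (m + 1 : ℕ) * Δ) * (max |a₁| |b₁| * ω * KE + (max |a₁| |b₁| * (ω + ω * (C / Δ)) + max |a₁| |b₁| * ω / 2)) +
        max |a₁| |b₁| * ω) +
      (t + (m + 1 : ℕ) * Δ - 0) * (2 * max |a₁| |b₁| * lam * ((Cθ * 1 + Cθ * (C / Δ)) + Cθ / 2) +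
        2 * max |a₁| |b₁| * lam * Cθ * KE + 0) ≤ δ)
    {δf thr : ℝ} (hδf : 11 * δ₁ ≤ δf) (hthr : ε' * ((m + 1 : ℕ) * Δ) < thr) :
    ∃ r₀ : ℝ, 0 < r₀ ∧ ∀ r : ℝ, 0 < r → r < r₀ → ∃ N₀ : ℕ, ∀ N : ℕ, N₀ ≤ N →
      localGibbsLaw σ a₀ u₀ θ₀ N (Φ N) {z | thr < ∫ s in Icc t (t + (m + 1 : ℕ) * Δ),
        ((∫ x, |empiricalDensityField ((Φ N).flow s z) (fun y => cone r y x) - ρ s x|) +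
          (∫ x, ‖empiricalMomentumField ((Φ N).flow s z) (fun y => cone r y x) - ρ s x • u s x‖) +
          ∫ x, |empiricalEnergyField ((Φ N).flow s z) (fun y => cone r y x) - totalEnergyDensity (ρ s x) (u s x) (θ s x)|)} ≤
        ENNReal.ofReal δf := by
  have htsh0 : 0 ≤ t + (m + 1 : ℕ) * Δ := by positivity
  have htshp : 0 < t + (m + 1 : ℕ) * Δ := by positivity
  have htshT : t + (m + 1 : ℕ) * Δ < T := by linarith
  have hHOR : 0 < t + (m + 1 : ℕ) * Δ + e := by linarith
  have hn0 : (0 : ℝ) < n := by exact_mod_cast hn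
  have hn'0 : (0 : ℝ) < n' := by exact_mod_cast hn'
  have hmesh : 0 < (t + (m + 1 : ℕ) * Δ) / n := div_pos htshp hn0
  have hδg : 0 < δ₁ / ((n : ℝ) + 1) := by positivity
  have hδg' : 0 < δ₁ / ((n' : ℝ) + 1) := by positivity
  have hτg : ∀ g : Fin (n + 1), 0 ≤ (g : ℝ) * ((t + (m + 1 : ℕ) * Δ) / n) ∧ (g : ℝ) * ((t + (m + 1 : ℕ) * Δ) / n) ≤ t + (m + 1 : ℕ) * Δ := by
    intro g
    refine ⟨by positivity, ?_⟩
    have hg : (g : ℝ) ≤ n := by exact_mod_cast Nat.lt_succ_iff.1 g.2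
    calc (g : ℝ) * ((t + (m + 1 : ℕ) * Δ) / n) ≤ n * ((t + (m + 1 : ℕ) * Δ) / n) := mul_le_mul_of_nonneg_right hg hmesh.le
      _ = t + (m + 1 : ℕ) * Δ := by field_simp
  have hτg' : ∀ g : Fin (n' + 1), 0 ≤ (g : ℝ) * ((t + (m + 1 : ℕ) * Δ - Δ) / n') ∧
      (g : ℝ) * ((t + (m + 1 : ℕ) * Δ - Δ) / n') ≤ t + (m + 1 : ℕ) * Δ - Δ := by
    intro g
    have hL0 : 0 ≤ t + (m + 1 : ℕ) * Δ - Δ := by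
      have hm1 : (1 : ℝ) ≤ ((m + 1 : ℕ) : ℝ) := by exact_mod_cast Nat.succ_le_succ (Nat.zero_le m)
      nlinarith
    refine ⟨by positivity, ?_⟩
    have hg : (g : ℝ) ≤ n' := by exact_mod_cast Nat.lt_succ_iff.1 g.2
    calc (g : ℝ) * ((t + (m + 1 : ℕ) * Δ - Δ) / n') ≤ n' * ((t + (m + 1 : ℕ) * Δ - Δ) / n') :=
        mul_le_mul_of_nonneg_right hg (div_nonneg hL0 hn'0.le)
      _ = t + (m + 1 : ℕ) * Δ - Δ := by field_simp
  -- ### the tests: bumps, traceless and symmetric parts of the clamped velocity gradient, entropy tests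
  have hu : Torus.IsSmoothSpaceTimeOn (Ico 0 T) u := hE.smooth_velocity
  have hbumpc : ∀ c w : ℝ, Continuous fun p : ℝ × T3 => max 0 (min 1 (min ((p.1 - c + w) / w) ((c + 2 * w - p.1) / w))) :=
    fun c w => (ChaosClosesEulerReadout.continuous_bump c w).comp continuous_fst
  have hcT : ∀ s : ℝ, max 0 (min s (t + (m + 1 : ℕ) * Δ)) + e ∈ Ico 0 T := fun s =>
    ⟨by linarith [(Literature.Analysis.FluidPDE.clamp_mem htsh0 s).1, he.le],
      by linarith [(Literature.Analysis.FluidPDE.clamp_mem htsh0 s).2]⟩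
  have hDc : ∀ i j : Fin 3, Continuous fun p : ℝ × T3 =>
      Torus.partialDeriv j (fun y => u (max 0 (min p.1 (t + (m + 1 : ℕ) * Δ)) + e) y i) p.2 := by
    intro i j
    have h1 := continuousOn_partialDeriv_apply hu j i
    have h2 : Continuous fun p : ℝ × T3 => (max 0 (min p.1 (t + (m + 1 : ℕ) * Δ)) + e, p.2) :=
      (((Literature.Analysis.FluidPDE.continuous_clamp _).comp continuous_fst).add continuous_const).prodMk continuous_snd
    exact h1.comp_continuous h2 fun p => ⟨hcT p.1, mem_univ _⟩
  -- ### the thresholds of the inputs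
  obtain ⟨r₀C, hr₀C, HC1⟩ := exists_threshold_forall_fin fun g : Fin (n + 1) =>
    HC _ (hbumpc ((g : ℝ) * ((t + (m + 1 : ℕ) * Δ) / n)) ((t + (m + 1 : ℕ) * Δ) / n)) η₃ _ hη₃ hδg
  obtain ⟨r₀0, hr₀0, HC0⟩ := HC _ (hbumpc 0 (t + (m + 1 : ℕ) * Δ)) η₃ δ₁ hη₃ hδ₁
  obtain ⟨r₀W, hr₀W, HW1⟩ := exists_threshold_forall_fin fun g : Fin (n + 1) =>
    HW ((g : ℝ) * ((t + (m + 1 : ℕ) * Δ) / n)) ⟨(hτg g).1, (hτg g).2.trans_lt htshT⟩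
      (fun i j p => Torus.partialDeriv j (fun y => u (max 0 (min p.1 (t + (m + 1 : ℕ) * Δ)) + e) y i) p.2 -
        if i = j then (∑ k : Fin 3, Torus.partialDeriv k (fun y => u (max 0 (min p.1 (t + (m + 1 : ℕ) * Δ)) + e) y k) p.2) / 3 else 0)
      (fun i j => by
        by_cases hij : i = j
        · simp only [hij, if_true]; exact (hDc j j).sub ((continuous_finsetSum _ fun k _ => hDc k k).div_const _)
        · simp only [hij, if_false, sub_zero]; exact hDc i j)
      (fun p => traceless_trace fun i j => Torus.partialDeriv j (fun y => u (max 0 (min p.1 (t + (m + 1 : ℕ) * Δ)) + e) y i) p.2)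
      ηW _ hηW hδg
  obtain ⟨r₀P, hr₀P, HP1⟩ := exists_threshold_forall_fin fun g : Fin (n + 1) =>
    HP ((g : ℝ) * ((t + (m + 1 : ℕ) * Δ) / n)) ⟨(hτg g).1, (hτg g).2.trans_lt htshT⟩
      (fun k l p => (Torus.partialDeriv l (fun y => u (max 0 (min p.1 (t + (m + 1 : ℕ) * Δ)) + e) y k) p.2 +
        Torus.partialDeriv k (fun y => u (max 0 (min p.1 (t + (m + 1 : ℕ) * Δ)) + e) y l) p.2) / 2)
      (fun k l => ((hDc k l).add (hDc l k)).div_const _) (fun k l p => by ring) ηP _ hηP hδg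
  obtain ⟨r₀L, hr₀L, HL1⟩ := exists_threshold_forall_fin fun g : Fin (n' + 1) =>
    HL (fun s x => Real.smoothTransition ((s + e / 2) / (e / 4)) * θ (s + e) x *
        Real.smoothTransition (((g : ℝ) * ((t + (m + 1 : ℕ) * Δ - Δ) / n') + Δ - s) / Δ))
      (entropyTest_smooth hθ he hΔ (by linarith [(hτg' g).2]))
      (entropyTest_nonneg he hΔ hE.temperature_pos (by linarith [(hτg' g).2]))
      ⟨(g : ℝ) * ((t + (m + 1 : ℕ) * Δ - Δ) / n') + Δ, by linarith [(hτg' g).2], fun s hs x => entropyTest_vanish hΔ s hs x⟩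
      ηL _ hηL hδg'
  obtain ⟨r₀D, hr₀D, HD1⟩ := HD ηcap δ₁ hcappos hδ₁
  obtain ⟨r₀I, hr₀I, HI1⟩ := HI δ δ₁ hδpos hδ₁
  -- ### the common threshold in `r`
  refine ⟨min (min (min r₀C r₀0) (min r₀W r₀P)) (min (min r₀L r₀D) (min r₀I (min (dX / 2) (1 / 4)))), by positivity, fun r hr hrlt => ?_⟩
  have h1 : min (min (min r₀C r₀0) (min r₀W r₀P)) (min (min r₀L r₀D) (min r₀I (min (dX / 2) (1 / 4)))) ≤ min (min r₀C r₀0) (min r₀W r₀P) := min_le_left _ _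
  have h2 : min (min (min r₀C r₀0) (min r₀W r₀P)) (min (min r₀L r₀D) (min r₀I (min (dX / 2) (1 / 4)))) ≤ min (min r₀L r₀D) (min r₀I (min (dX / 2) (1 / 4))) := min_le_right _ _
  obtain ⟨N₀C, HC2⟩ := HC1 r hr (hrlt.trans_le ((h1.trans (min_le_left _ _)).trans (min_le_left _ _)))
  obtain ⟨N₀0, HC02⟩ := HC0 r hr (hrlt.trans_le ((h1.trans (min_le_left _ _)).trans (min_le_right _ _)))
  obtain ⟨N₀W, HW2⟩ := HW1 r hr (hrlt.trans_le ((h1.trans (min_le_right _ _)).trans (min_le_left _ _)))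
  obtain ⟨N₀P, HP2⟩ := HP1 r hr (hrlt.trans_le ((h1.trans (min_le_right _ _)).trans (min_le_right _ _)))
  obtain ⟨N₀L, HL2⟩ := HL1 r hr (hrlt.trans_le ((h2.trans (min_le_left _ _)).trans (min_le_left _ _)))
  obtain ⟨N₀D, HD2⟩ := HD1 r hr (hrlt.trans_le ((h2.trans (min_le_left _ _)).trans (min_le_right _ _)))
  obtain ⟨N₀I, HI2⟩ := HI1 r hr (hrlt.trans_le ((h2.trans (min_le_right _ _)).trans (min_le_left _ _)))
  have hrX : r < dX / 2 := hrlt.trans_le (((h2.trans (min_le_right _ _)).trans (min_le_right _ _)).trans (min_le_left _ _))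
  have hr2 : r < 1 / 2 := by
    have := hrlt.trans_le (((h2.trans (min_le_right _ _)).trans (min_le_right _ _)).trans (min_le_right _ _))
    linarith
  obtain ⟨N₀ε, Hε⟩ := exists_hsDiameter_le σ (e := min (dX / 2) ε₁) (by positivity)
  -- NEW (v8): beyond `N₀κ` the cold cones are `lam²`-thin at this `r`
  obtain ⟨N₀κ, Hκ⟩ := stub_reductionFrameE (3 / (Real.pi * r ^ 3)) (pow_pos hlam 2)
  -- ### the common threshold in `N`
  refine ⟨max (max (max (max N₀C N₀0) (max N₀W N₀P)) (max (max N₀L N₀D) (max (max N₀I N₀U) N₀ε))) N₀κ, fun N hN' => ?_⟩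
  have hN : max (max (max N₀C N₀0) (max N₀W N₀P)) (max (max N₀L N₀D) (max (max N₀I N₀U) N₀ε)) ≤ N := (le_max_left _ _).trans hN'
  have hNκ : N₀κ ≤ N := (le_max_right _ _).trans hN'
  have k1 : max (max N₀C N₀0) (max N₀W N₀P) ≤ N := (le_max_left _ _).trans hN
  have k2 : max (max N₀L N₀D) (max (max N₀I N₀U) N₀ε) ≤ N := (le_max_right _ _).trans hN
  have hNC : N₀C ≤ N := ((le_max_left _ _).trans (le_max_left _ _)).trans k1
  have hN0 : N₀0 ≤ N := ((le_max_right _ _).trans (le_max_left _ _)).trans k1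
  have hNW : N₀W ≤ N := ((le_max_left _ _).trans (le_max_right _ _)).trans k1
  have hNP : N₀P ≤ N := ((le_max_right _ _).trans (le_max_right _ _)).trans k1
  have hNL : N₀L ≤ N := ((le_max_left _ _).trans (le_max_left _ _)).trans k2
  have hND : N₀D ≤ N := ((le_max_right _ _).trans (le_max_left _ _)).trans k2
  have hNI : N₀I ≤ N := (((le_max_left _ _).trans (le_max_left _ _)).trans (le_max_right _ _)).trans k2
  have hNU : N₀U ≤ N := (((le_max_right _ _).trans (le_max_left _ _)).trans (le_max_right _ _)).trans k2
  have hNε : N₀ε ≤ N := ((le_max_right _ _).trans (le_max_right _ _)).trans k2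
  have hεX : hsDiameter σ N ≤ dX / 2 := (Hε N hNε).trans (min_le_left _ _)
  have hε₁' : hsDiameter σ N ≤ ε₁ := (Hε N hNε).trans (min_le_right _ _)
  -- the `N`-dependent terms of the momentum budget
  have hε : 0 < hsDiameter σ N := hsDiameter_pos hσ N
  have hN1 : (1 : ℝ) ≤ (N + 1 : ℝ) := by have : (0 : ℝ) ≤ N := Nat.cast_nonneg N; linarith
  have hT3 : 3 / 2 * Cu * hsDiameter σ N * (2 * (N + 1 : ℝ)⁻¹ + 8 * KE) ≤ B3 := by
    have hinv : (N + 1 : ℝ)⁻¹ ≤ 1 := inv_le_one_of_one_le₀ hN1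
    have hinv0 : 0 ≤ (N + 1 : ℝ)⁻¹ := by positivity
    have ha : 2 * (N + 1 : ℝ)⁻¹ + 8 * KE ≤ 2 + 8 * KE := by linarith [hinv]
    have hb : 3 / 2 * Cu * hsDiameter σ N ≤ 3 / 2 * Cu * ε₁ := mul_le_mul_of_nonneg_left hε₁' (by positivity)
    calc 3 / 2 * Cu * hsDiameter σ N * (2 * (N + 1 : ℝ)⁻¹ + 8 * KE) ≤ 3 / 2 * Cu * hsDiameter σ N * (2 + 8 * KE) :=
          mul_le_mul_of_nonneg_left ha (by positivity)
      _ ≤ 3 / 2 * Cu * ε₁ * (2 + 8 * KE) := mul_le_mul_of_nonneg_right hb (by positivity)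
      _ ≤ B3 := hB3
  have hωx' : ∀ s ∈ Icc 0 (t + (m + 1 : ℕ) * Δ), ∀ x y : T3, Torus.euclidDist x y < r + hsDiameter σ N →
      ∀ i j : Fin 3, |Torus.partialDeriv j (fun y => u (s + e) y i) x - Torus.partialDeriv j (fun y' => u (s + e) y' i) y| ≤ ωx :=
    fun s hs x y hxy => hωx s hs x y (hxy.trans_le (by linarith))
  exact reduction_events_cold hσ hσ2 (Φ N) (localGibbsLaw σ a₀ u₀ θ₀ N (Φ N)) hr hr2 hE ht0 hΔ he hT hχ hf hB0 hB hband hfband hFc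
    hSH hδpos.le hlam hlam1 (Hκ N hNκ) hη₀g0 hguard hcap0 hη₁cap hg12 hη₀gg hcapg hKE0 hCY0 hCY hn hne hCu hut hD hω hωu hωt hωD hωx0 hωx' hθ hCθ hθb
    hθt hθx hωθ hωθt hωθx hC1 hC2 hn' (by linarith [hT3]) hS3 hδ₁.le hδf hthr
    (localGibbsLaw_absolutelyContinuous σ a₀ u₀ θ₀ N (Φ N)) (HKE N) (HD2 N hND) (HU N hNU)
    (stub_reductionFrameB _ fun g => HC2 N hNC g) (HC02 N hN0) (stub_reductionFrameB _ fun g => HW2 N hNW g)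
    (stub_reductionFrameB _ fun g => HP2 N hNP g) (stub_reductionFrameB _ fun g => HL2 N hNL g)
    (HI2 N hNI).1 (HI2 N hNI).2.1 (HI2 N hNI).2.2

end Summit.AtomisticToContinuum.HydrodynamicLimit.Theorems.ChaosClosesEulerReduction

end
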